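import Literature.NumberTheory.Automorphic.LocalSchwartzBruhatDirectSum
import Literature.NumberTheory.Automorphic.LocalPiSchwartzBruhatFourier
import Literature.NumberTheory.Automorphic.TateLocalZetaShells
import Literature.RepresentationTheory.HeisenbergGroup.TateWeylPair
import HarnessLib

/-!
# Linear functionals on `𝒮(K^{ι₁} × K^{ι₂})` that are eigen under multiplication by `ψ(b·Q(x'))` are carried by a
# quadric shell `{Q = q₀} × K^{ι₂}` (IV-4(c1) piece P6 of the Hodge/COR-CM cell, part 1: SUPPORT)

Topic `RepresentationTheory/HeisenbergGroup`; namespace `Literature.RepresentationTheory.HeisenbergGroup`.  KERNEL ONLY: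
theorems; no definition, no named fact, no record, no `sorry`.  Generic non-archimedean analysis over the tree's
Schwartz–Bruhat spaces `SchwartzBruhat (ι → K)` (`TateLocalFactors`: locally constant, compactly supported) and the coordinate
splitting `e : ι₁ ⊕ ι₂ ≃ ι` (`glue/resL/resR/boxSB`, `LocalSchwartzBruhatDirectSum`).  Sequel:
`SchwartzBruhatQuadricUncertainty.lean` (partial Fourier transform, uncertainty, the consumed statement).

DEF-FREE CURRENCY.  For a linear functional `D` on `𝒮(K^ι)` and `V ⊆ K^{ι₁}`, «`D` kills everything `ι₁`-supported in `V`»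
stands for `∀ Φ, (∀ x, Φ x ≠ 0 → resL e x ∈ V) → D Φ = 0` (spelled out in every statement).

* §0 cut-offs `1_B · Φ` by cosets `B` of boxes stay Schwartz–Bruhat.
* §1 `vanish_of_forall_nhds` — LOCAL-TO-GLOBAL: if every point of `V` has an open neighbourhood `U` such that `D` kills
  everything `ι₁`-supported in `U`, then `D` kills everything `ι₁`-supported in `V` (a Lebesgue number of the compact
  `ι₁`-support in the form of a box `(𝔭^N)^{ι₁}` — cosets of a box that meet are equal — and the level-`N` coset
  decomposition `exists_finset_eq_sum_indicator_pi`).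
* §2 `exists_quadric_support_of_mulChar_eigen` — QUADRIC SUPPORT: for `Q : K^{ι₁} → K` continuous and `ψ` continuous
  non-trivial, if for every `b ∈ K` there is `κ_b` with `D(ψ(b·Q(x'))·Φ) = κ_b·D(Φ)` for all `Φ` (eigenfunctional of the
  second-degree characters of a root subgroup, [MoeglinVignerasWaldspurger1987, Chap. 2 II.6]), then `D = 0` or there is `q₀`
  with `D` killing everything `ι₁`-supported in `{Q ≠ q₀}`: the closed set of points near which `D` does not vanish is
  `Q`-constant, because two `Q`-values are separated by some `ψ(b·)` and the eigen-identity forces vanishing near the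
  point whose value differs from `κ_b`.  (`b ↦ κ_b` is never identified.)

Consumer: row IV-4(c1) `rankOne_theta_lines_disjoint_holds` (A-p15's support-form plan, pieces P1–P7; this is P6 (a)).
Folklore p-adic analysis ([WeilBNT1967, Chap. VII §2; Bruhat1961]); nothing of the cited sources is asserted.

## References
* [WeilBNT1967] A. Weil, *Basic Number Theory* (1967), Chap. II §2 (boxes), Chap. VII §2 Prop. 2 (standard functions).
* [MoeglinVignerasWaldspurger1987] C. Mœglin, M.-F. Vignéras, J.-L. Waldspurger, LNM 1291 (1987), Chap. 2 II.6.
* [Bruhat1961] F. Bruhat, *Distributions sur un groupe localement compact*, Bull. SMF 89 (1961), §9.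
-/

set_option autoImplicit false

noncomputable section

open MeasureTheory Filter
open scoped NNReal Topology Pointwise
open Literature.NumberTheory.Automorphic
open Literature.NumberTheory.GaloisRepresentations.IsNonarchimedeanLocalField

namespace Literature.RepresentationTheory.HeisenbergGroup

/-! ## §0 Two bookkeeping lemmas -/

section Prelim

variable {K : Type*} [Field K] [ValuativeRel K] [TopologicalSpace K] [IsNonarchimedeanLocalField K]
  {ι₁ ι₂ ι : Type*} [Fintype ι] (e : ι₁ ⊕ ι₂ ≃ ι)

/-- cutting a Schwartz–Bruhat function off by a coset of a box gives a Schwartz–Bruhat function.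
[cite: WeilBNT1967, Chap. VII §2, Def. 1] -/
theorem indicator_vadd_piPrimePowBall_mul_mem_schwartzBruhat (N : ℤ) (a : ι → K) (Φ : SchwartzBruhat (ι → K)) :
    (fun x => (a +ᵥ piPrimePowBall K ι N).indicator (fun _ => (1 : ℂ)) x * (Φ : (ι → K) → ℂ) x) ∈
      SchwartzBruhat (ι → K) := by
  have h1 := indicator_vadd_piPrimePowBall_mem_schwartzBruhat (F := K) (ι := ι) N a (1 : ℂ)
  rw [mem_schwartzBruhat_iff] at h1 ⊢
  exact ⟨h1.1.mul Φ.2.1, Φ.2.2.mul_left⟩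

end Prelim

section Prelim₀

/-- the value of a cut-off function: `(1_B · Φ)(x) = Φ(x)` on `B` and `0` off `B`. [cite: WeilBNT1967, Chap. VII §2, Def. 1] -/
theorem indicator_mul_apply_eq {X : Type*} (B : Set X) (Φ : X → ℂ) (x : X) :
    B.indicator (fun _ => (1 : ℂ)) x * Φ x = B.indicator Φ x := by
  by_cases hx : x ∈ B
  · rw [Set.indicator_of_mem hx, Set.indicator_of_mem hx, one_mul]
  · rw [Set.indicator_of_notMem hx, Set.indicator_of_notMem hx, zero_mul]

end Prelim₀

/-! ## §1 Local-to-global vanishing in the `ι₁`-variables -/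

section LocalGlobal

variable {K : Type*} [Field K] [ValuativeRel K] [TopologicalSpace K] [IsNonarchimedeanLocalField K]
  {ι₁ ι₂ ι : Type*} [Fintype ι₁] [Fintype ι] (e : ι₁ ⊕ ι₂ ≃ ι)

/-- **LOCAL-TO-GLOBAL.**  Let `D` be a linear functional on `𝒮(K^ι)`, `K^ι = K^{ι₁} × K^{ι₂}` along `e`, and `V ⊆ K^{ι₁}`.
If every `x' ∈ V` has an open neighbourhood `U` such that `D Φ = 0` for every `Φ` whose `ι₁`-support lies in `U`, then
`D Φ = 0` for every `Φ` whose `ι₁`-support lies in `V`.  (The `ι₁`-support `resL(supp Φ)` is compact; a Lebesgue number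
in the form of a box `(𝔭^N)^{ι₁}` exists because cosets of a box that meet are equal; then `Φ = Σ_B 1_B Φ` over cosets
`B` of `(𝔭^N)^ι`, each piece `ι₁`-supported in one coset of `(𝔭^N)^{ι₁}`.) [cite: WeilBNT1967, Chap. VII §2, Prop. 2] -/
theorem vanish_of_forall_nhds (D : SchwartzBruhat (ι → K) →ₗ[ℂ] ℂ) {V : Set (ι₁ → K)}
    (hV : ∀ x' ∈ V, ∃ U : Set (ι₁ → K), IsOpen U ∧ x' ∈ U ∧
      ∀ Φ : SchwartzBruhat (ι → K), (∀ x, (Φ : (ι → K) → ℂ) x ≠ 0 → resL e x ∈ U) → D Φ = 0)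
    (Φ : SchwartzBruhat (ι → K)) (hΦ : ∀ x, (Φ : (ι → K) → ℂ) x ≠ 0 → resL e x ∈ V) : D Φ = 0 := by
  classical
  -- the `ι₁`-support `S₁ = resL(tsupport Φ)` is compact and lies in `V`
  set Φf : (ι → K) → ℂ := (Φ : (ι → K) → ℂ) with hΦf
  have hcl : tsupport Φf = Function.support Φf := by
    refine IsClosed.closure_eq ⟨?_⟩
    have : (Function.support Φf)ᶜ = Φf ⁻¹' {0} := by
      ext x
      simp only [Set.mem_compl_iff, Function.mem_support, ne_eq, not_not, Set.mem_preimage, Set.mem_singleton_iff]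
    rw [this]
    exact Φ.2.1.isOpen_fiber 0
  set S₁ : Set (ι₁ → K) := resL e '' tsupport Φf with hS₁
  have hS₁c : IsCompact S₁ := Φ.2.2.isCompact.image (continuous_resL e)
  have hS₁V : ∀ s ∈ S₁, s ∈ V := by
    rintro s ⟨x, hx, rfl⟩
    rw [hcl] at hx
    exact hΦ x hx
  -- a box level `n s` at each point of `S₁`, and a uniform level `N`
  have hloc : ∀ s ∈ S₁, ∃ n : ℕ, ∀ Ψ : SchwartzBruhat (ι → K),
      (∀ x, (Ψ : (ι → K) → ℂ) x ≠ 0 → resL e x ∈ s +ᵥ piPrimePowBall K ι₁ (n : ℤ)) → D Ψ = 0 := by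
    intro s hs
    obtain ⟨U, hUo, hsU, hU⟩ := hV s (hS₁V s hs)
    have hW : (fun t => s + t) ⁻¹' U ∈ 𝓝 (0 : ι₁ → K) :=
      (continuous_const.add continuous_id).continuousAt.preimage_mem_nhds (by simpa using hUo.mem_nhds hsU)
    obtain ⟨n, hn⟩ := exists_piPrimePowBall_subset_of_mem_nhds_zero hW
    refine ⟨n, fun Ψ hΨ => hU Ψ fun x hx => ?_⟩
    obtain ⟨t, ht, hxt⟩ := Set.mem_vadd_set.1 (hΨ x hx)
    rw [← hxt]
    exact hn ht
  choose! n hn using hloc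
  obtain ⟨A, hA⟩ := hS₁c.elim_finite_subcover (fun s : S₁ => (s : ι₁ → K) +ᵥ piPrimePowBall K ι₁ (n s : ℤ))
    (fun s => isOpen_vadd_piPrimePowBall _ _)
    (fun s hs => Set.mem_iUnion.2 ⟨⟨s, hs⟩, self_mem_vadd_piPrimePowBall _ _⟩)
  set N : ℤ := ((A.sup fun s => n (s : ι₁ → K) : ℕ) : ℤ) with hN
  -- KEY: `D` kills everything `ι₁`-supported in `s₀ + (𝔭^N)^{ι₁}` for every `s₀ ∈ S₁`
  have hkill : ∀ s₀ ∈ S₁, ∀ Ψ : SchwartzBruhat (ι → K),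
      (∀ x, (Ψ : (ι → K) → ℂ) x ≠ 0 → resL e x ∈ s₀ +ᵥ piPrimePowBall K ι₁ N) → D Ψ = 0 := by
    intro s₀ hs₀ Ψ hΨ
    obtain ⟨i, hi, hs₀i⟩ := Set.mem_iUnion₂.1 (hA hs₀)
    have hle : (n (i : ι₁ → K) : ℤ) ≤ N := by
      rw [hN]
      exact_mod_cast Finset.le_sup (f := fun s : S₁ => n (s : ι₁ → K)) hi
    refine hn (i : ι₁ → K) i.2 Ψ fun x hx => ?_
    have h1 : resL e x ∈ s₀ +ᵥ piPrimePowBall K ι₁ (n (i : ι₁ → K) : ℤ) := by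
      obtain ⟨t, ht, hxt⟩ := Set.mem_vadd_set.1 (hΨ x hx)
      exact Set.mem_vadd_set.2 ⟨t, piPrimePowBall_antitone hle ht, hxt⟩
    rwa [vadd_piPrimePowBall_eq_of_mem hs₀i] at h1
  -- decompose `Φ` at level `N` over `K^ι` and kill each piece
  obtain ⟨C, hC, hsum⟩ := exists_finset_eq_sum_indicator_pi Φ.2 N
  have hpiece : ∀ B ∈ C, ∃ P : SchwartzBruhat (ι → K), ((P : (ι → K) → ℂ) = B.indicator Φf) ∧ D P = 0 := by
    intro B hB
    obtain ⟨a, rfl⟩ := hC B hB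
    refine ⟨⟨_, indicator_vadd_piPrimePowBall_mul_mem_schwartzBruhat N a Φ⟩,
      funext fun x => indicator_mul_apply_eq _ Φf x, ?_⟩
    by_cases h0 : ∀ x, (a +ᵥ piPrimePowBall K ι N).indicator (fun _ => (1 : ℂ)) x * Φf x = 0
    · have : (⟨_, indicator_vadd_piPrimePowBall_mul_mem_schwartzBruhat N a Φ⟩ : SchwartzBruhat (ι → K)) = 0 :=
        Subtype.ext (funext h0)
      rw [this, map_zero]
    · push Not at h0
      obtain ⟨x₀, hx₀⟩ := h0
      rw [indicator_mul_apply_eq] at hx₀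
      have hx₀B : x₀ ∈ a +ᵥ piPrimePowBall K ι N := Set.mem_of_indicator_ne_zero hx₀
      have hΦx₀ : Φf x₀ ≠ 0 := by
        intro h
        exact hx₀ (by rw [Set.indicator_of_mem hx₀B, h])
      have hs₀ : resL e x₀ ∈ S₁ := ⟨x₀, subset_tsupport _ (Function.mem_support.2 hΦx₀), rfl⟩
      refine hkill (resL e x₀) hs₀ _ fun y hy => ?_
      change (a +ᵥ piPrimePowBall K ι N).indicator (fun _ => (1 : ℂ)) y * Φf y ≠ 0 at hy
      rw [indicator_mul_apply_eq] at hy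
      have hyB : y ∈ a +ᵥ piPrimePowBall K ι N := Set.mem_of_indicator_ne_zero hy
      have hy1 := ((mem_vadd_piPrimePowBall_iff_resL_resR K e a y).1 hyB).1
      have hx1 := ((mem_vadd_piPrimePowBall_iff_resL_resR K e a x₀).1 hx₀B).1
      rwa [← vadd_piPrimePowBall_eq_of_mem hx1] at hy1
  choose! P hP using hpiece
  have hΦsum : Φ = ∑ B ∈ C, P B := by
    apply Subtype.ext
    funext u
    rw [hsum u, AddSubmonoidClass.coe_finsetSum, Finset.sum_apply]
    exact Finset.sum_congr rfl fun B hB => by rw [(hP B hB).1]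
  rw [hΦsum, map_sum]
  exact Finset.sum_eq_zero fun B hB => (hP B hB).2

end LocalGlobal

/-! ## §2 Quadric support of a `ψ(b·Q(x'))`-eigenfunctional -/

section QuadricSupport

variable {K : Type*} [Field K] [ValuativeRel K] [TopologicalSpace K] [IsNonarchimedeanLocalField K]
  {ι₁ ι₂ ι : Type*} [Fintype ι₁] [Fintype ι] (e : ι₁ ⊕ ι₂ ≃ ι)
  {ψ : AddChar K Circle} (hψ : ψ.IsContinuousNontrivial)

include hψ in
/-- **QUADRIC SUPPORT (KEY P6 (a)).**  Let `Q : K^{ι₁} → K` be continuous, `ψ` a continuous non-trivial additive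
character and `D` a linear functional on `𝒮(K^{ι₁} × K^{ι₂})` such that for every `b ∈ K` there is `κ_b ∈ ℂ` with
`D(ψ(b·Q(x'))·Φ) = κ_b · D(Φ)` for all `Φ` (the eigen-property under the root subgroup acting by second-degree
characters, [MoeglinVignerasWaldspurger1987, Chap. 2 II.6]).  Then EITHER `D = 0`, OR there is `q₀ ∈ K` such that `D`
kills every `Φ` whose `ι₁`-support lies in `{Q ≠ q₀}` — `D` is carried by the quadric shell `{Q = q₀} × K^{ι₂}`.  Proof:
the set of points near which `D` does not vanish is `Q`-constant — if `Q x₀ ≠ Q x₁` pick `b` with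
`ψ(b·Q x₀) ≠ ψ(b·Q x₁)`; `κ_b` differs from one of them, and near that point `ψ(b·Q)` is constant so the eigen-identity
forces `D = 0` there — then §1.  (`b ↦ κ_b` need not be identified.) [cite: MoeglinVignerasWaldspurger1987, Chap. 2 II.6] -/
theorem exists_quadric_support_of_mulChar_eigen (Q : (ι₁ → K) → K) (hQ : Continuous Q)
    (D : SchwartzBruhat (ι → K) →ₗ[ℂ] ℂ)
    (hD : ∀ b : K, ∃ κ : ℂ, ∀ Φ Ψ : SchwartzBruhat (ι → K),
      (∀ x, (Ψ : (ι → K) → ℂ) x = ((ψ (b * Q (resL e x)) : Circle) : ℂ) * (Φ : (ι → K) → ℂ) x) → D Ψ = κ * D Φ) :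
    D = 0 ∨ ∃ q₀ : K, ∀ Φ : SchwartzBruhat (ι → K),
      (∀ x, (Φ : (ι → K) → ℂ) x ≠ 0 → Q (resL e x) ≠ q₀) → D Φ = 0 := by
  classical
  -- the generic step: if `ψ(b·Q x') ≠ κ_b` then `D` vanishes near `x'`
  have step : ∀ (b : K) (κ : ℂ), (∀ Φ Ψ : SchwartzBruhat (ι → K),
      (∀ x, (Ψ : (ι → K) → ℂ) x = ((ψ (b * Q (resL e x)) : Circle) : ℂ) * (Φ : (ι → K) → ℂ) x) → D Ψ = κ * D Φ) →
      ∀ x' : ι₁ → K, ((ψ (b * Q x') : Circle) : ℂ) ≠ κ →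
      ∀ Φ : SchwartzBruhat (ι → K),
        (∀ x, (Φ : (ι → K) → ℂ) x ≠ 0 → resL e x ∈ {z : ι₁ → K | ψ (b * Q z) = ψ (b * Q x')}) → D Φ = 0 := by
    intro b κ hκ x' hne Φ hΦ
    have hΨ := hκ Φ (((ψ (b * Q x') : Circle) : ℂ) • Φ) fun x => by
      rw [SetLike.val_smul, Pi.smul_apply, smul_eq_mul]
      by_cases hx : (Φ : (ι → K) → ℂ) x = 0
      · rw [hx, mul_zero, mul_zero]
      · rw [show ψ (b * Q (resL e x)) = ψ (b * Q x') from hΦ x hx]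
    rw [map_smul, smul_eq_mul] at hΨ
    have h0 : (((ψ (b * Q x') : Circle) : ℂ) - κ) * D Φ = 0 := by rw [sub_mul, hΨ, sub_self]
    exact (mul_eq_zero.1 h0).resolve_left (sub_ne_zero.2 hne)
  have hlc : ∀ b : K, IsLocallyConstant fun x' : ι₁ → K => ψ (b * Q x') := fun b =>
    (isLocallyConstant_of_isContinuousNontrivial hψ).comp_continuous (continuous_const.mul hQ)
  by_cases hall : ∀ x' : ι₁ → K, ∃ U : Set (ι₁ → K), IsOpen U ∧ x' ∈ U ∧
      ∀ Φ : SchwartzBruhat (ι → K), (∀ x, (Φ : (ι → K) → ℂ) x ≠ 0 → resL e x ∈ U) → D Φ = 0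
  · left
    refine LinearMap.ext fun Φ => ?_
    exact vanish_of_forall_nhds e D (V := Set.univ) (fun x' _ => hall x') Φ fun x _ => Set.mem_univ _
  · right
    push Not at hall
    obtain ⟨x₀, hx₀⟩ := hall
    refine ⟨Q x₀, vanish_of_forall_nhds e D fun x₁ (hx₁ : Q x₁ ≠ Q x₀) => ?_⟩
    -- a `b` separating the two `Q`-values
    obtain ⟨y, hy⟩ := AddChar.ne_zero_iff.1 hψ.2
    have hd : Q x₁ - Q x₀ ≠ 0 := sub_ne_zero.2 hx₁
    set b : K := y / (Q x₁ - Q x₀) with hb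
    have hsep : ψ (b * Q x₁) ≠ ψ (b * Q x₀) := by
      intro h
      apply hy
      have h1 : ψ (b * Q x₁ - b * Q x₀) = 1 := by rw [AddChar.map_sub_eq_div, h, div_self']
      rwa [← mul_sub, hb, div_mul_cancel₀ _ hd] at h1
    obtain ⟨κ, hκ⟩ := hD b
    by_cases h₁ : ((ψ (b * Q x₁) : Circle) : ℂ) = κ
    · -- then `κ ≠ ψ(b·Q x₀)`, so `D` vanishes near `x₀`: contradiction
      exfalso
      have hne₀ : ((ψ (b * Q x₀) : Circle) : ℂ) ≠ κ := fun h =>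
        hsep (Circle.coe_injective (h₁.trans h.symm))
      obtain ⟨Φ, hΦ, hDΦ⟩ := hx₀ {z | ψ (b * Q z) = ψ (b * Q x₀)} ((hlc b).isOpen_fiber _) rfl
      exact hDΦ (step b κ hκ x₀ hne₀ Φ hΦ)
    · exact ⟨{z | ψ (b * Q z) = ψ (b * Q x₁)}, (hlc b).isOpen_fiber _, rfl, step b κ hκ x₁ h₁⟩

end QuadricSupport

end Literature.RepresentationTheory.HeisenbergGroup

end
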